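import Mathlib
import HarnessLib
import Summits.HubbardSuperconductivity.HubbardSuperconductivity.Theorems.KLProgrammeKLRegimeSplitPhRotationLatticeWeighted
import Summits.HubbardSuperconductivity.HubbardSuperconductivity.Theorems.KLProgrammeKLRegimeSplitPhRotationRow

/-!
# Route `KLProgramme` — ENGINE (stmt-HubbardSuperconductivity-20437 `KLRegimeEngineV17F2`), row (c) binder #8 (★ v19 `hexLadMV`), value rows `RP/RQ`, brick O6i-c (row form):
# THE ANGLE-RESOLVED FROZEN PART OF THE ZERO-TRANSFER p-h VALUE ROW — `Σ_pΣ_σ(Ẇ_tβL²ĝ_p)(Φ_jβL²ĝ_p)·V₀ p σ` with a reference field whose `σ`-sum is an ANGULAR WEIGHT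
# `w₁(p_k̃) + i·w₂(p_k̃)` (radially constant in the C4a chart) is `(Λₙ−Λₙ₊₁) × (B_v·rotation sizes + lattice rate)` for EACH of `w₁, w₂` — the twin of O6c with `V₀(ϑ)`
# (cell gate-hubbard-kl, seat hubbard-kl-k3c2-p2 g32, technique «thermal-bar induction n ≤ nScales β + 1 with EngineBoundsAtV4S sums»)

WHY.  O6c (`klph_phValue_row_le`) is the rows-door spelling of the rotation lemma for a CONSTANT frozen kernel product `V₀`; the CAVEAT of this seat (KL STATUS 05:15Z) is that the
product must be frozen PER Fermi-surface angle to realise the corner law.  With O6i-a/b (`klpw_planar/lattice_rotation_weighted_le`) the rotation null holds against any angular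
weight; this file rewrites that in the rows door's spelling, for a reference field `V₀ : FreqMomentum → Fin 2 → ℂ` with
`Σ_σ V₀ p σ = w₁(p_k̃) + i·w₂(p_k̃)` (`p_k̃ = latticeMomentum`, `w₁, w₂` admissible planar weights: continuous, doubly `2π`-periodic, `L_w`-Lipschitz, `|w| ≤ B_w`, radially constant
in the chart with angular profiles `v₁, v₂`, measurable, `2π`-periodic, `|v| ≤ B_v`):

* `klpw_sum_propCT_sq_weighted_eq` — dictionary: `Σ_p G(s_p)·ĝ_p²·c(k̃_p) = Σ_k̃ c(k̃)·(Σ_ν G(s)(e² − ω²)/s² : ℝ)`;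
* **`klpw_phValue_row_weighted_le`** — `(Λₙ−Λₙ₊₁)((βL²)³)⁻¹·‖Σ_pΣ_σ(Ẇ_tβL²ĝ)(Φ_jβL²ĝ)·V₀ p σ‖ ≤ (Λₙ−Λₙ₊₁)·(𝔅_w(B_v,B_w,L_w) + 𝔅_w(B_v,B_w,L_w))`,
  `𝔅_w` = the bound of `klpw_lattice_rotation_weighted_le` at `r₂ = Λ(t)` — together with O6e″ (`klph_phValue_row_profile_ref_le`) this is the COMPLETE closer-side treatment of
  `RP` at the diagonal in the corner-law currency: rotation per angle + window-profile moduli.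
Pure composition; no definitions; nothing asserts (c), K3 or superconductivity.  [cite: BenfattoGiulianiMastropietro2006, §2.4–§2.5]
-/

noncomputable section

namespace Summit.HubbardSuperconductivity.HubbardSuperconductivity.Theorems.KLRegimeSplit

set_option linter.dupNamespace false -- summit = problem name (single-conjunct summit), D-0017

open Real Set Finset Literature.MathematicalPhysics.QuantumLattice Literature.Probability.LatticeModels
open Literature.MathematicalPhysics.QuantumLattice.BandSectorCounting
open Summit.HubbardSuperconductivity.HubbardSuperconductivity.Theorems.TwoPointAssembly
open Summit.HubbardSuperconductivity.HubbardSuperconductivity.Theorems.KLProgrammeLegKernels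
open Summit.HubbardSuperconductivity.HubbardSuperconductivity.Theorems.KLRegimeWick
open Summit.HubbardSuperconductivity.HubbardSuperconductivity.Theorems.EngineV8
open Summit.HubbardSuperconductivity.HubbardSuperconductivity.Theorems.DispersionFlow
open Summit.HubbardSuperconductivity.HubbardSuperconductivity.Theorems.PerturbedFermiCurve
open Summit.HubbardSuperconductivity.HubbardSuperconductivity.Theorems.C4a

variable {L M : ℕ} [NeZero L] [NeZero M]

omit [NeZero M] in
/-- **Dictionary with a momentum weight**: `Σ_{(ν,k̃)} G(ω_ν² + e_K²)·ĝ_K(ν,k̃)²·c(k̃) = Σ_k̃ c(k̃)·(Σ_ν G(s)(e_K² − ω_ν²)/s² : ℝ)`. -/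
theorem klpw_sum_propCT_sq_weighted_eq {β : ℝ} (hβ : β ≠ 0) (μ : ℝ) (K : TrigPolyC4v) (G : ℝ → ℝ) (c : TorusSite 2 L → ℂ) :
    ∑ p : FreqMomentum L M, (G (matsubaraFreq β M p.1 ^ 2 + nambuXiCT L μ K p.2 ^ 2) : ℂ) * propCT L M β μ K p ^ 2 * c p.2 =
      ∑ k : TorusSite 2 L, c k * ((∑ ν : MatsubaraIdx M, G (matsubaraFreq β M ν ^ 2 + nambuXiCT L μ K k ^ 2) *
        (nambuXiCT L μ K k ^ 2 - matsubaraFreq β M ν ^ 2) / (matsubaraFreq β M ν ^ 2 + nambuXiCT L μ K k ^ 2) ^ 2 : ℝ) : ℂ) := by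
  rw [Fintype.sum_prod_type, Finset.sum_comm]
  refine Finset.sum_congr rfl fun k _ => ?_
  have h := klod_sum_even_mul_propCT_sq μ K hβ (fun ν => G (matsubaraFreq β M ν ^ 2 + nambuXiCT L μ K k ^ 2))
    (fun ν => by simp only [matsubaraFreq_rev, neg_sq]) k
  simp only at h ⊢
  calc ∑ x : MatsubaraIdx M, (G (matsubaraFreq β M x ^ 2 + nambuXiCT L μ K k ^ 2) : ℂ) * propCT L M β μ K (x, k) ^ 2 * c k
      = (∑ x : MatsubaraIdx M, (G (matsubaraFreq β M x ^ 2 + nambuXiCT L μ K k ^ 2) : ℂ) * propCT L M β μ K (x, k) ^ 2) * c k := by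
        rw [Finset.sum_mul]
    _ = _ := by rw [h]; ring

section Row

variable {a b : ℝ} (B : BandBounds a b) {K : TrigPolyC4v} {A : ℝ}
  (hA : ∀ p : Momentum, ∀ j ≤ 2, ‖iteratedFDeriv ℝ j (frameShift K) p‖ ≤ A) (hADt : 2 * A < B.Dtmin)
  {μ r : ℝ} (hlo : a < μ - r - A) (hhi : μ + r + A < b)
include B hA hADt hlo hhi

/-- **THE ANGLE-RESOLVED FROZEN PART OF THE ZERO-TRANSFER p-h VALUE ROW (module docstring).** [cite: BenfattoGiulianiMastropietro2006, §2.4–§2.5] -/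
theorem klpw_phValue_row_weighted_le {β : ℝ} (hβ : 0 < β) (n : ℕ) {t : ℝ} (ht : t ∈ Icc (0 : ℝ) 1)
    (Φ : ℕ → ℝ → FreqMomentum L M → ℝ) (hΦ : Φ = fun j t k => (softSymbolCompl L M β μ K (n + 1) j) k + (hubbardCutoffWeightCT L M β μ K (klScale klE0 (n + 1)) k -
            hubbardCutoffWeightCT L M β μ K (klScale klE0 n + t * (klScale klE0 (n + 1) - klScale klE0 n)) k))
    (Wd : ℝ → FreqMomentum L M → ℝ) (hWd : Wd = fun t k => deriv (fun Λ' : ℝ => hubbardCutoffWeightCT L M β μ K Λ' k) (klScale klE0 n + t * (klScale klE0 (n + 1) - klScale klE0 n)))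
    (j : ℕ) (hΛr : klScale klE0 n + t * (klScale klE0 (n + 1) - klScale klE0 n) < r)
    (hM : β * (klScale klE0 n + t * (klScale klE0 (n + 1) - klScale klE0 n)) / (2 * Real.pi) + 1 ≤ M)
    {Mg ℓ r₁ : ℝ} (hr₁ : 0 < r₁)
    (hbd : ∀ s, |klWd (klScale klE0 n + t * (klScale klE0 (n + 1) - klScale klE0 n)) s *
      klPhi (klScale klE0 j) (klScale klE0 n + t * (klScale klE0 (n + 1) - klScale klE0 n)) s| ≤ Mg)
    (hlip : ∀ s s', |klWd (klScale klE0 n + t * (klScale klE0 (n + 1) - klScale klE0 n)) s *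
        klPhi (klScale klE0 j) (klScale klE0 n + t * (klScale klE0 (n + 1) - klScale klE0 n)) s -
      klWd (klScale klE0 n + t * (klScale klE0 (n + 1) - klScale klE0 n)) s' *
        klPhi (klScale klE0 j) (klScale klE0 n + t * (klScale klE0 (n + 1) - klScale klE0 n)) s'| ≤ ℓ * |s - s'|)
    (hin : ∀ s, s ≤ r₁ ^ 2 → klWd (klScale klE0 n + t * (klScale klE0 (n + 1) - klScale klE0 n)) s *
      klPhi (klScale klE0 j) (klScale klE0 n + t * (klScale klE0 (n + 1) - klScale klE0 n)) s = 0)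
    (hout : ∀ s, (klScale klE0 n + t * (klScale klE0 (n + 1) - klScale klE0 n)) ^ 2 ≤ s →
      klWd (klScale klE0 n + t * (klScale klE0 (n + 1) - klScale klE0 n)) s *
        klPhi (klScale klE0 j) (klScale klE0 n + t * (klScale klE0 (n + 1) - klScale klE0 n)) s = 0)
    -- the angular weights
    (w₁ w₂ : ℝ × ℝ → ℝ) (v₁ v₂ : ℝ → ℝ) (hvm₁ : Measurable v₁) (hvm₂ : Measurable v₂) (hvp₁ : Function.Periodic v₁ (2 * π)) (hvp₂ : Function.Periodic v₂ (2 * π))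
    {Bv : ℝ} (hvb₁ : ∀ ϑ, |v₁ ϑ| ≤ Bv) (hvb₂ : ∀ ϑ, |v₂ ϑ| ≤ Bv)
    (hw₁ : ∀ p : ℝ × ℝ, p.1 ∈ Ioo (-r) r → w₁ (levelChart μ K p) = v₁ p.2) (hw₂ : ∀ p : ℝ × ℝ, p.1 ∈ Ioo (-r) r → w₂ (levelChart μ K p) = v₂ p.2)
    (hwc₁ : Continuous w₁) (hwc₂ : Continuous w₂) (hw1₁ : ∀ x y, w₁ (x + 2 * π, y) = w₁ (x, y)) (hw2₁ : ∀ x y, w₁ (x, y + 2 * π) = w₁ (x, y))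
    (hw1₂ : ∀ x y, w₂ (x + 2 * π, y) = w₂ (x, y)) (hw2₂ : ∀ x y, w₂ (x, y + 2 * π) = w₂ (x, y))
    {Lw Bw : ℝ} (hLw : 0 ≤ Lw) (hwlip₁ : ∀ p q : ℝ × ℝ, |w₁ p - w₁ q| ≤ Lw * dist p q) (hwlip₂ : ∀ p q : ℝ × ℝ, |w₂ p - w₂ q| ≤ Lw * dist p q)
    (hwb₁ : ∀ p, |w₁ p| ≤ Bw) (hwb₂ : ∀ p, |w₂ p| ≤ Bw)
    -- the reference field: its spin sum is the angular weight at the lattice momentum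
    (V₀ : FreqMomentum L M → Fin 2 → ℂ)
    (hV : ∀ p : FreqMomentum L M, ∑ σ : Fin 2, V₀ p σ =
      ((w₁ (latticeMomentum L p.2 0, latticeMomentum L p.2 1) : ℝ) : ℂ) + ((w₂ (latticeMomentum L p.2 0, latticeMomentum L p.2 1) : ℝ) : ℂ) * Complex.I) :
    (klScale klE0 n - klScale klE0 (n + 1)) * ((β * (L : ℝ) ^ 2) ^ 3)⁻¹ *
      ‖∑ p : FreqMomentum L M, ∑ σ : Fin 2,
        (((((Wd t p) : ℝ) : ℂ) * (((β * (L : ℝ) ^ 2 : ℝ) : ℂ) * propCT L M β μ K p)) * ((((Φ j t p) : ℝ) : ℂ) * (((β * (L : ℝ) ^ 2 : ℝ) : ℂ) * propCT L M β μ K p))) *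
          V₀ p σ‖ ≤
      (klScale klE0 n - klScale klE0 (n + 1)) * (2 *
        (((2 * π) ^ 2)⁻¹ * (Bv * (2 * π * (π * Real.sqrt 2 / (B.Dtmin - 2 * A)) *
              ((2 * (klScale klE0 n + t * (klScale klE0 (n + 1) - klScale klE0 n)) * (2 * (klScale klE0 n + t * (klScale klE0 (n + 1) - klScale klE0 n)) *
                (2 * (klScale klE0 n + t * (klScale klE0 (n + 1) - klScale klE0 n)) ^ 2 * (ℓ / r₁ ^ 4 + 2 * Mg / r₁ ^ 6) + (ℓ / r₁ ^ 2 + Mg / r₁ ^ 4)))) *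
                ((klScale klE0 n + t * (klScale klE0 (n + 1) - klScale klE0 n)) + 2 * Real.pi / β) / β) +
            β⁻¹ * (((klScale klE0 n + t * (klScale klE0 (n + 1) - klScale klE0 n)) * β / π + 1) *
              (2 * (klScale klE0 n + t * (klScale klE0 (n + 1) - klScale klE0 n)) *
                (2 * π * (1 / (B.Dtmin - 2 * A) ^ 2 + Real.pi * Real.sqrt 2 * (2 + 4 * A) / (B.Dtmin - 2 * A) ^ 3) *
                  (klScale klE0 n + t * (klScale klE0 (n + 1) - klScale klE0 n)) * (Mg / r₁ ^ 2)))))) +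
          ((klScale klE0 n + t * (klScale klE0 (n + 1) - klScale klE0 n)) / π + 3 / β) *
            (2 * π * (Bw * (2 * (klScale klE0 n + t * (klScale klE0 (n + 1) - klScale klE0 n)) *
              (2 * (klScale klE0 n + t * (klScale klE0 (n + 1) - klScale klE0 n)) ^ 2 * (ℓ / r₁ ^ 4 + 2 * Mg / r₁ ^ 6) + (ℓ / r₁ ^ 2 + Mg / r₁ ^ 4)) *
              (4 + 2 * A)) + Lw * (Mg / r₁ ^ 2)) / L))) := by
  set Λt : ℝ := klScale klE0 n + t * (klScale klE0 (n + 1) - klScale klE0 n) with hΛt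
  have hβ0 : β ≠ 0 := hβ.ne'
  have hL : (0 : ℝ) < L := by exact_mod_cast Nat.pos_of_ne_zero (NeZero.ne L)
  have hβL : 0 < β * (L : ℝ) ^ 2 := by positivity
  have hΛ1 := klth_klScale_pos (n + 1)
  have hsucc : klScale klE0 (n + 1) = klScale klE0 n / 4 := klth_klScale_succ n
  have hΛt1 : klScale klE0 (n + 1) ≤ Λt := by rw [hΛt, hsucc]; obtain ⟨h0, h1⟩ := ht; nlinarith
  have hΛt0 : 0 < Λt := hΛ1.trans_le hΛt1
  set G : ℝ → ℝ := fun s => klWd Λt s * klPhi (klScale klE0 j) Λt s with hG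
  set hk : TorusSite 2 L → ℝ := fun k => ∑ ν : MatsubaraIdx M, G (matsubaraFreq β M ν ^ 2 + nambuXiCT L μ K k ^ 2) *
    (nambuXiCT L μ K k ^ 2 - matsubaraFreq β M ν ^ 2) / (matsubaraFreq β M ν ^ 2 + nambuXiCT L μ K k ^ 2) ^ 2 with hhk
  -- the double sum: `(βL²)²·Σ_p G ĝ² (Σ_σ V₀ p σ) = (βL²)²·(Σ_k w₁ h_k + i Σ_k w₂ h_k)`
  have hsum : ∑ p : FreqMomentum L M, ∑ σ : Fin 2,
        (((((Wd t p) : ℝ) : ℂ) * (((β * (L : ℝ) ^ 2 : ℝ) : ℂ) * propCT L M β μ K p)) * ((((Φ j t p) : ℝ) : ℂ) * (((β * (L : ℝ) ^ 2 : ℝ) : ℂ) * propCT L M β μ K p))) * V₀ p σ =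
      (((β * (L : ℝ) ^ 2 : ℝ)) : ℂ) ^ 2 *
        (((∑ k : TorusSite 2 L, w₁ (latticeMomentum L k 0, latticeMomentum L k 1) * hk k : ℝ) : ℂ) +
          ((∑ k : TorusSite 2 L, w₂ (latticeMomentum L k 0, latticeMomentum L k 1) * hk k : ℝ) : ℂ) * Complex.I) := by
    have hstep : ∀ p : FreqMomentum L M, ∑ σ : Fin 2,
        (((((Wd t p) : ℝ) : ℂ) * (((β * (L : ℝ) ^ 2 : ℝ) : ℂ) * propCT L M β μ K p)) * ((((Φ j t p) : ℝ) : ℂ) * (((β * (L : ℝ) ^ 2 : ℝ) : ℂ) * propCT L M β μ K p))) * V₀ p σ =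
        (((β * (L : ℝ) ^ 2 : ℝ)) : ℂ) ^ 2 * ((G (matsubaraFreq β M p.1 ^ 2 + nambuXiCT L μ K p.2 ^ 2) : ℂ) * propCT L M β μ K p ^ 2 *
          (((w₁ (latticeMomentum L p.2 0, latticeMomentum L p.2 1) : ℝ) : ℂ) + ((w₂ (latticeMomentum L p.2 0, latticeMomentum L p.2 1) : ℝ) : ℂ) * Complex.I)) := by
      intro p
      rw [← Finset.mul_sum, hV p, hWd, hΦ, klok_bornLines_eq hβ0 μ K n j hΛt0.ne' p]
      ring
    rw [Finset.sum_congr rfl fun p _ => hstep p, ← Finset.mul_sum]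
    congr 1
    have h1 := klpw_sum_propCT_sq_weighted_eq (L := L) (M := M) hβ0 μ K G (fun k => ((w₁ (latticeMomentum L k 0, latticeMomentum L k 1) : ℝ) : ℂ))
    have h2 := klpw_sum_propCT_sq_weighted_eq (L := L) (M := M) hβ0 μ K G (fun k => ((w₂ (latticeMomentum L k 0, latticeMomentum L k 1) : ℝ) : ℂ))
    simp only [mul_add, Finset.sum_add_distrib]
    rw [h1]
    have : ∑ p : FreqMomentum L M, (G (matsubaraFreq β M p.1 ^ 2 + nambuXiCT L μ K p.2 ^ 2) : ℂ) * propCT L M β μ K p ^ 2 *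
        (((w₂ (latticeMomentum L p.2 0, latticeMomentum L p.2 1) : ℝ) : ℂ) * Complex.I) =
        (∑ p : FreqMomentum L M, (G (matsubaraFreq β M p.1 ^ 2 + nambuXiCT L μ K p.2 ^ 2) : ℂ) * propCT L M β μ K p ^ 2 *
          ((w₂ (latticeMomentum L p.2 0, latticeMomentum L p.2 1) : ℝ) : ℂ)) * Complex.I := by
      rw [Finset.sum_mul]; exact Finset.sum_congr rfl fun p _ => by ring
    rw [this, h2]
    push_cast
    simp only [hhk]
    push_cast
    ring
  -- the weighted lattice rotation lemma for each weight
  have hrot₁ := klpw_lattice_rotation_weighted_le B hA hADt hlo hhi hβ hbd hlip hin hout hr₁ hΛt0 hΛr hM w₁ v₁ hvm₁ hvp₁ hvb₁ hw₁ hwc₁ hw1₁ hw2₁ hLw hwlip₁ hwb₁ L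
  have hrot₂ := klpw_lattice_rotation_weighted_le B hA hADt hlo hhi hβ hbd hlip hin hout hr₁ hΛt0 hΛr hM w₂ v₂ hvm₂ hvp₂ hvb₂ hw₂ hwc₂ hw1₂ hw2₂ hLw hwlip₂ hwb₂ L
  -- reorder the sums inside hrot: Σ_i (L²)⁻¹ Σ_k w f = (L²)⁻¹ Σ_k w Σ_i f
  have hre : ∀ (w : ℝ × ℝ → ℝ), β⁻¹ * ∑ i : MatsubaraIdx M, ((L ^ 2 : ℕ) : ℝ)⁻¹ * ∑ k : TorusSite 2 L,
        w (latticeMomentum L k 0, latticeMomentum L k 1) *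
          (G (matsubaraFreq β M i ^ 2 + nambuXiCT L μ K k ^ 2) * (nambuXiCT L μ K k ^ 2 - matsubaraFreq β M i ^ 2) /
            (matsubaraFreq β M i ^ 2 + nambuXiCT L μ K k ^ 2) ^ 2) =
      β⁻¹ * (((L ^ 2 : ℕ) : ℝ)⁻¹ * ∑ k : TorusSite 2 L, w (latticeMomentum L k 0, latticeMomentum L k 1) * hk k) := by
    intro w
    rw [← Finset.mul_sum, Finset.sum_comm]
    congr 2
    refine Finset.sum_congr rfl fun k _ => ?_
    rw [hhk, Finset.mul_sum]
  rw [hre w₁] at hrot₁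
  rw [hre w₂] at hrot₂
  rw [hsum, norm_mul, norm_pow, Complex.norm_real, Real.norm_of_nonneg hβL.le]
  have hL2 : (((L ^ 2 : ℕ) : ℝ)) = (L : ℝ) ^ 2 := by push_cast; ring
  rw [hL2] at hrot₁ hrot₂
  -- `‖a + b·I‖ ≤ |a| + |b|`
  have hnorm_le : ‖(((∑ k : TorusSite 2 L, w₁ (latticeMomentum L k 0, latticeMomentum L k 1) * hk k : ℝ) : ℂ) +
          ((∑ k : TorusSite 2 L, w₂ (latticeMomentum L k 0, latticeMomentum L k 1) * hk k : ℝ) : ℂ) * Complex.I)‖ ≤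
      |∑ k : TorusSite 2 L, w₁ (latticeMomentum L k 0, latticeMomentum L k 1) * hk k| +
        |∑ k : TorusSite 2 L, w₂ (latticeMomentum L k 0, latticeMomentum L k 1) * hk k| := by
    refine (norm_add_le _ _).trans ?_
    rw [norm_mul, Complex.norm_I, mul_one, Complex.norm_real, Complex.norm_real, Real.norm_eq_abs, Real.norm_eq_abs]
  -- normalisation: `(Λd)((βL²)³)⁻¹(βL²)²|S| = (Λd)|β⁻¹(L²)⁻¹ S|`
  have hnormal : ∀ S : ℝ, (klScale klE0 n - klScale klE0 (n + 1)) * ((β * (L : ℝ) ^ 2) ^ 3)⁻¹ * ((β * (L : ℝ) ^ 2) ^ 2 * |S|) =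
      (klScale klE0 n - klScale klE0 (n + 1)) * |β⁻¹ * (((L : ℝ) ^ 2)⁻¹ * S)| := by
    intro S
    rw [abs_mul, abs_mul, abs_of_pos (inv_pos.2 hβ), abs_of_pos (inv_pos.2 (by positivity : (0 : ℝ) < (L : ℝ) ^ 2))]
    field_simp
  have hdiff : 0 ≤ klScale klE0 n - klScale klE0 (n + 1) := by rw [hsucc]; linarith
  have hC : 0 ≤ (klScale klE0 n - klScale klE0 (n + 1)) * ((β * (L : ℝ) ^ 2) ^ 3)⁻¹ * (β * (L : ℝ) ^ 2) ^ 2 := by positivity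
  calc (klScale klE0 n - klScale klE0 (n + 1)) * ((β * (L : ℝ) ^ 2) ^ 3)⁻¹ * ((β * (L : ℝ) ^ 2) ^ 2 *
        ‖(((∑ k : TorusSite 2 L, w₁ (latticeMomentum L k 0, latticeMomentum L k 1) * hk k : ℝ) : ℂ) +
          ((∑ k : TorusSite 2 L, w₂ (latticeMomentum L k 0, latticeMomentum L k 1) * hk k : ℝ) : ℂ) * Complex.I)‖)
      ≤ (klScale klE0 n - klScale klE0 (n + 1)) * ((β * (L : ℝ) ^ 2) ^ 3)⁻¹ * ((β * (L : ℝ) ^ 2) ^ 2 *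
          (|∑ k : TorusSite 2 L, w₁ (latticeMomentum L k 0, latticeMomentum L k 1) * hk k| +
            |∑ k : TorusSite 2 L, w₂ (latticeMomentum L k 0, latticeMomentum L k 1) * hk k|)) := by
        rw [← mul_assoc, ← mul_assoc]
        exact mul_le_mul_of_nonneg_left hnorm_le hC
    _ = (klScale klE0 n - klScale klE0 (n + 1)) * |β⁻¹ * (((L : ℝ) ^ 2)⁻¹ * ∑ k : TorusSite 2 L, w₁ (latticeMomentum L k 0, latticeMomentum L k 1) * hk k)| +
        (klScale klE0 n - klScale klE0 (n + 1)) * |β⁻¹ * (((L : ℝ) ^ 2)⁻¹ * ∑ k : TorusSite 2 L, w₂ (latticeMomentum L k 0, latticeMomentum L k 1) * hk k)| := by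
        rw [mul_add, mul_add, hnormal, hnormal]
    _ ≤ _ := by
        have h1 := mul_le_mul_of_nonneg_left hrot₁ hdiff
        have h2 := mul_le_mul_of_nonneg_left hrot₂ hdiff
        linarith

end Row

end Summit.HubbardSuperconductivity.HubbardSuperconductivity.Theorems.KLRegimeSplit

end
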